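/-
Copyright: pub-lace10 cell (eng seat): split-edge form of the N = 0 lower cells of [FvdH17] Lemma 5.3 — kernel identities + edge monotonicity; Level-C plumbing for inventory rows C-9…C-12.
-/
import Literature.Probability.FitznerVanDerHofstad2017.NobleBoundsN0PsiLowerHexAll
import HarnessLib

/-!
# The engines' `N = 0` lower cells (`Ψ̂^{(0),κ}` and `Π^{(0),α}`) in split-edge form ARE the monotone closed forms of Lemma 5.3 (kernel identities)

HONEST FRAMING. An identity of polynomials and its one-line corollary; no new estimate, no percolation input beyond the
cited tree theorem. The lace-expansion record engines (lace7 `eng2`, stack `ST10′`, d := 10) price `Ψ̂^{(0),κ}_p(0)` from below by the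
notebook cell `Bound[Psi,lower,0,s] = psiK12[s] + psiL3[s] + psiH3[s]` (tokens `psiker + l3ker + k3off + h3ker`; `psiH3` = the text of
`h123k_spec_g32.json`, sha256 `af3601ee…`), evaluated with the split-edge convention `z[i] = 1/(2d−1)` in the positive main terms and
`z[s]` in the subtracted terms, and with the letters `Bound[G,max,2,s] ↦ Tmax`, `Bound[G,{1},3,s] ↦ T3`, `Bound[G,{0,1},2,s] ↦ T2`,
`Bound[G,{2},2,s] ↦ T11`.  `psiLowerCell d zi zs Tmax T3 T2 T11` below is that text transcribed verbatim (two-variable form); `piAlphaLowerCell` is the companion cell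
`Bound[Pi,alpha,lower,0,s]` (tokens k1def + k1ker, row-file field `k1ker.form`).
`psiLowerCell_diag_eq` says that on the diagonal `zi = zs = p` it is *literally* the left side of
`FvdH17ext_L53_psiZero_lines12345_lower_of_tau_le` with `T21 = T111 = Tmax` (proved by `ring` after unfolding `hexOneBracket`,
`hexOneLossPoly`), and `psiLowerCell_diag_le` re-exports that theorem in the engine's letters; `psiLowerCell_split_le` licenses the split-edge EVALUATION
(`zi ≤ p ≤ zs`, letters `≥ 0`, hexagon bracket `≥ 0` at the upper edge).  `piAlphaLowerCell_diag_eq / _diag_le / _split_le` do the same for the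
`Π^{(0),α}` cell against `FvdH17ext_L53_piAlpha_lower_of_tau_le`.  What is NOT here: the Level-C recipe cells reading the letters from the
Assumption-4.3 input fields, and any claim about the letters' values at `d = 10`.
-/

set_option autoImplicit false

noncomputable section

namespace Literature.Probability.FitznerVanDerHofstad2017

open _root_.MeasureTheory Literature.Barriers.CriticalPhenomena Literature.Probability.Percolation
open Literature.Probability.LatticeModels
open scoped BigOperators ENNReal

namespace N0Cells

variable {d : ℕ}

/-- **The engine cell `Bound[Psi,lower,0,s]` of the all-kernel `N = 0` stack** (`psiK12 + psiL3 + psiH3`, tokens psiker + l3ker + k3off + h3ker),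
transcribed verbatim in the two edge variables `zi` (main terms) and `zs` (subtracted terms) and the letters `Tmax, T3, T2, T11`.
[cite: FitznerVanDerHofstad2017, Lemma 5.3 (5.25) lines 1–5 (extended version arXiv:1506.07977v1 p. 48)] -/
def psiLowerCell (d : ℕ) (zi zs Tmax T3 T2 T11 : ℝ) : ℝ :=
  -- psiK12[s]  (psiker; k1ker letters T21 = T111 = Bound[G,max,2,s] = Tmax)
  ((2 * (d : ℝ) - 2) ^ 2 * zi ^ 4 - (2 * (d : ℝ) - 2) * zs ^ 4 * (2 * T2 + 2 * (2 * (d : ℝ) - 3) * T11 + 2 * Tmax + (2 * (d : ℝ) - 4) * Tmax) -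
      (2 * (d : ℝ) - 2) ^ 2 * zs ^ 4 * T3 - (2 * (d : ℝ) - 2) * (2 * (d : ℝ) - 3) ^ 2 * zs ^ 7) +
  -- psiL3[s]  (l3ker)
  (2 * ((d : ℝ) - 1) ^ 2 * zi ^ 4 - 2 * ((d : ℝ) - 1) ^ 2 * zs ^ 4 * (Tmax + 2 * T11 + T3)) +
  -- psiH3[s]  (h3ker SPEC text, h123k_spec_g32.json; psiL45 = 0 under k3off)
  (16 * ((d : ℝ) - 1) * ((d : ℝ) - 2) * (2 * (d : ℝ) - 5) * zi ^ 6 *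
      (1 - ((2 * (d : ℝ) - 2) * zs ^ 3 + zs + 2 * zs ^ 2 + 4 * zs ^ 3 + 4 * zs ^ 2 + 5 * zs ^ 3 + 11 * zs ^ 4 + 31 * zs ^ 5 +
        4 * ((d : ℝ) - 3) * (2 * zs ^ 3 + 12 * zs ^ 4 + 32 * zs ^ 5) + 32 * ((d : ℝ) - 3) ^ 2 * zs ^ 5) - 5 * Tmax - T3) +
    2 * ((d : ℝ) - 1) * ((d : ℝ) - 2) * zi ^ 6 *
      (((d : ℝ) - 2) * (16 - 8 * zs - 40 * zs ^ 2 - 56 * zs ^ 3 - 104 * zs ^ 4 - 32 * zs ^ 5 - 16 * zs ^ 6 - 16 * T3 - 80 * Tmax) -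
        ((d : ℝ) - 3) ^ 2 * (16 * zs ^ 3 + 144 * zs ^ 4 + 64 * zs ^ 5 + 32 * zs ^ 6)) +
    (3 / 2) * (2 * (d : ℝ) - 2) * (2 * (d : ℝ) - 3) * (2 * (d : ℝ) - 4) * zi ^ 6 * (1 - 8 * zs ^ 2 - 5 * Tmax - T3))

/-- **Kernel identity (inventory row C-12 «SPEC text = theorem polynomial»)**: on the diagonal `zi = zs = p` the engine cell is literally the
left side of `FvdH17ext_L53_psiZero_lines12345_lower_of_tau_le` with `T21 = T111 = Tmax`.
[cite: FitznerVanDerHofstad2017, Lemma 5.3 (5.25) lines 1–5 (extended version arXiv:1506.07977v1 p. 48)] -/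
theorem psiLowerCell_diag_eq (d : ℕ) (p : unitInterval) (Tmax T3 T2 T11 : ℝ) :
    psiLowerCell d (p : ℝ) (p : ℝ) Tmax T3 T2 T11 =
      (p : ℝ) * ((2 * d - 2 : ℝ) ^ 2 * (p : ℝ) ^ 3 -
        ((p : ℝ) ^ 3 * ((2 * d - 2 : ℝ) * (2 * T2 + 2 * (2 * d - 3 : ℝ) * T11 + 2 * Tmax + (2 * d - 4 : ℝ) * Tmax)) +
          (2 * d - 2 : ℝ) ^ 2 * (p : ℝ) ^ 3 * T3 + (2 * d - 2 : ℝ) * (2 * d - 3) ^ 2 * (p : ℝ) ^ 6)) +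
      2 * ((d : ℝ) - 1) ^ 2 * (p : ℝ) ^ 4 * (1 - Tmax - 2 * T11 - T3) +
      16 * ((d : ℝ) - 1) * ((d : ℝ) - 2) * (2 * (d : ℝ) - 5) * ((p : ℝ) ^ 6 * hexOneBracket d p Tmax T3) +
      2 * ((d : ℝ) - 1) * ((d : ℝ) - 2) * (p : ℝ) ^ 6 *
        (((d : ℝ) - 2) * (16 - 8 * (p : ℝ) - 40 * (p : ℝ) ^ 2 - 56 * (p : ℝ) ^ 3 - 104 * (p : ℝ) ^ 4 -
            32 * (p : ℝ) ^ 5 - 16 * (p : ℝ) ^ 6 - 16 * T3 - 80 * Tmax) -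
          ((d : ℝ) - 3) ^ 2 * (16 * (p : ℝ) ^ 3 + 144 * (p : ℝ) ^ 4 + 64 * (p : ℝ) ^ 5 + 32 * (p : ℝ) ^ 6)) +
      (3 / 2) * ((2 * d - 2 : ℝ) * (2 * d - 3) * (2 * d - 4)) * ((p : ℝ) ^ 6 * (1 - 8 * (p : ℝ) ^ 2 - 5 * Tmax - T3)) := by
  simp only [psiLowerCell, hexOneBracket, hexOneLossPoly]
  ring

/-- **The engine cell on the diagonal is a lower bound for `Ψ̂^{(0),κ}_p(0)`** — `FvdH17ext_L53_psiZero_lines12345_lower_of_tau_le` re-exported in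
the engine's letters (`T21 = T111 = Tmax`), for `3 ≤ d`.
[cite: FitznerVanDerHofstad2017, Lemma 5.3 (5.25) lines 1–5 (extended version arXiv:1506.07977v1 p. 48), proof §6.1 p. 61] -/
theorem psiLowerCell_diag_le (hd : 3 ≤ d) (p : unitInterval) (hp : p < criticalProbI d)
    {a b c : Fin d} (hab : a ≠ b) (hac : a ≠ c) (hbc : b ≠ c) {T2 T11 T3 Tmax : ℝ}
    (h2 : tau d p 0 (Pi.single a 2) ≤ T2) (h11 : tau d p 0 (Pi.single a 1 + Pi.single b 1) ≤ T11)
    (h21 : tau d p 0 (Pi.single a 2 + Pi.single b 1) ≤ Tmax)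
    (h111 : tau d p 0 (Pi.single a 1 + Pi.single b 1 + Pi.single c 1) ≤ Tmax) (h3 : tauGe d p 3 (unitSite1 d) ≤ T3)
    (hT2 : T2 ≤ T11)
    (hmax : ∀ z : Site d, z ≠ 0 → (∀ ν : Fin d × Bool, z ≠ stepVec ν) → tau d p 0 z ≤ Tmax) (κ : Fin d × Bool) :
    psiLowerCell d (p : ℝ) (p : ℝ) Tmax T3 T2 T11 ≤ ∑' x, noblePsiN d p (stepVec κ) 0 x := by
  rw [psiLowerCell_diag_eq]
  exact FvdH17ext_L53_psiZero_lines12345_lower_of_tau_le hd p hp hab hac hbc h2 h11 h21 h111 h3 hT2 le_rfl hmax κ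

/-! ### The split-edge evaluation is licensed: monotone in the main-term edge, antitone in the subtracted edge -/

/-- The `zs`-bracket `B` of the hexagon addend: `psiH3 = zi⁶ · B(zs)`. [cite: FitznerVanDerHofstad2017, Lemma 5.3 (5.25) lines 4–5 (extended version arXiv:1506.07977v1 p. 48)] -/
def psiHexBracket (d : ℕ) (zs Tmax T3 : ℝ) : ℝ :=
  16 * ((d : ℝ) - 1) * ((d : ℝ) - 2) * (2 * (d : ℝ) - 5) *
      (1 - ((2 * (d : ℝ) - 2) * zs ^ 3 + zs + 2 * zs ^ 2 + 4 * zs ^ 3 + 4 * zs ^ 2 + 5 * zs ^ 3 + 11 * zs ^ 4 + 31 * zs ^ 5 +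
        4 * ((d : ℝ) - 3) * (2 * zs ^ 3 + 12 * zs ^ 4 + 32 * zs ^ 5) + 32 * ((d : ℝ) - 3) ^ 2 * zs ^ 5) - 5 * Tmax - T3) +
    2 * ((d : ℝ) - 1) * ((d : ℝ) - 2) *
      (((d : ℝ) - 2) * (16 - 8 * zs - 40 * zs ^ 2 - 56 * zs ^ 3 - 104 * zs ^ 4 - 32 * zs ^ 5 - 16 * zs ^ 6 - 16 * T3 - 80 * Tmax) -
        ((d : ℝ) - 3) ^ 2 * (16 * zs ^ 3 + 144 * zs ^ 4 + 64 * zs ^ 5 + 32 * zs ^ 6)) +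
    (3 / 2) * (2 * (d : ℝ) - 2) * (2 * (d : ℝ) - 3) * (2 * (d : ℝ) - 4) * (1 - 8 * zs ^ 2 - 5 * Tmax - T3)

/-- The lines-1–3 part in split-edge form. [cite: FitznerVanDerHofstad2017, Lemma 5.3 (5.25) lines 1–3 (extended version arXiv:1506.07977v1 p. 48)] -/
def psiLines123 (d : ℕ) (zi zs Tmax T3 T2 T11 : ℝ) : ℝ :=
  ((2 * (d : ℝ) - 2) ^ 2 + 2 * ((d : ℝ) - 1) ^ 2) * zi ^ 4 -
    zs ^ 4 * ((2 * (d : ℝ) - 2) * (2 * T2 + 2 * (2 * (d : ℝ) - 3) * T11 + 2 * Tmax + (2 * (d : ℝ) - 4) * Tmax) +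
      (2 * (d : ℝ) - 2) ^ 2 * T3 + 2 * ((d : ℝ) - 1) ^ 2 * (Tmax + 2 * T11 + T3)) -
    (2 * (d : ℝ) - 2) * (2 * (d : ℝ) - 3) ^ 2 * zs ^ 7

/-- `psiLowerCell = psiLines123 + zi⁶ · B(zs)` (regrouping of the cell text). [cite: FitznerVanDerHofstad2017, Lemma 5.3 (5.25) lines 1–5; notebook Percolation.nb cell [109] (tokens psiker + l3ker + h3ker)] -/
theorem psiLowerCell_eq_split (d : ℕ) (zi zs Tmax T3 T2 T11 : ℝ) :
    psiLowerCell d zi zs Tmax T3 T2 T11 = psiLines123 d zi zs Tmax T3 T2 T11 + zi ^ 6 * psiHexBracket d zs Tmax T3 := by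
  simp only [psiLowerCell, psiLines123, psiHexBracket]
  ring

/-- `B` is antitone in `zs` on `[0, ∞)` for `3 ≤ d` (the subtracted edge of the split-edge convention). [cite: FitznerVanDerHofstad2017, §6.1 (6.45)–(6.47); notebook Percolation.nb cell [109] (split-edge evaluation convention of the record's oracle row)] -/
theorem psiHexBracket_antitone (hd : 3 ≤ d) {q zs : ℝ} (hq : 0 ≤ q) (hqzs : q ≤ zs) (Tmax T3 : ℝ) :
    psiHexBracket d zs Tmax T3 ≤ psiHexBracket d q Tmax T3 := by
  have hdR : (3 : ℝ) ≤ (d : ℝ) := by exact_mod_cast hd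
  have h1 : q ≤ zs := hqzs
  have h2 : q ^ 2 ≤ zs ^ 2 := pow_le_pow_left₀ hq hqzs 2
  have h3 : q ^ 3 ≤ zs ^ 3 := pow_le_pow_left₀ hq hqzs 3
  have h4 : q ^ 4 ≤ zs ^ 4 := pow_le_pow_left₀ hq hqzs 4
  have h5 : q ^ 5 ≤ zs ^ 5 := pow_le_pow_left₀ hq hqzs 5
  have h6 : q ^ 6 ≤ zs ^ 6 := pow_le_pow_left₀ hq hqzs 6
  have hd1 : (0 : ℝ) ≤ (d : ℝ) - 1 := by linarith
  have hd2 : (0 : ℝ) ≤ (d : ℝ) - 2 := by linarith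
  have hd3 : (0 : ℝ) ≤ (d : ℝ) - 3 := by linarith
  have h2d5 : (0 : ℝ) ≤ 2 * (d : ℝ) - 5 := by linarith
  have h2d2 : (0 : ℝ) ≤ 2 * (d : ℝ) - 2 := by linarith
  -- the three `zs`-polynomials are monotone
  have hL : (2 * (d : ℝ) - 2) * q ^ 3 + q + 2 * q ^ 2 + 4 * q ^ 3 + 4 * q ^ 2 + 5 * q ^ 3 + 11 * q ^ 4 + 31 * q ^ 5 +
        4 * ((d : ℝ) - 3) * (2 * q ^ 3 + 12 * q ^ 4 + 32 * q ^ 5) + 32 * ((d : ℝ) - 3) ^ 2 * q ^ 5 ≤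
      (2 * (d : ℝ) - 2) * zs ^ 3 + zs + 2 * zs ^ 2 + 4 * zs ^ 3 + 4 * zs ^ 2 + 5 * zs ^ 3 + 11 * zs ^ 4 + 31 * zs ^ 5 +
        4 * ((d : ℝ) - 3) * (2 * zs ^ 3 + 12 * zs ^ 4 + 32 * zs ^ 5) + 32 * ((d : ℝ) - 3) ^ 2 * zs ^ 5 := by
    have e1 := mul_le_mul_of_nonneg_left h3 h2d2
    have e2 : 4 * ((d : ℝ) - 3) * (2 * q ^ 3 + 12 * q ^ 4 + 32 * q ^ 5) ≤
        4 * ((d : ℝ) - 3) * (2 * zs ^ 3 + 12 * zs ^ 4 + 32 * zs ^ 5) :=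
      mul_le_mul_of_nonneg_left (by linarith) (by positivity)
    have e3 := mul_le_mul_of_nonneg_left h5 (show (0 : ℝ) ≤ 32 * ((d : ℝ) - 3) ^ 2 by positivity)
    linarith
  have hM : 8 * q + 40 * q ^ 2 + 56 * q ^ 3 + 104 * q ^ 4 + 32 * q ^ 5 + 16 * q ^ 6 ≤
      8 * zs + 40 * zs ^ 2 + 56 * zs ^ 3 + 104 * zs ^ 4 + 32 * zs ^ 5 + 16 * zs ^ 6 := by linarith
  have hN : 16 * q ^ 3 + 144 * q ^ 4 + 64 * q ^ 5 + 32 * q ^ 6 ≤ 16 * zs ^ 3 + 144 * zs ^ 4 + 64 * zs ^ 5 + 32 * zs ^ 6 := by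
    linarith
  have c1 : (0 : ℝ) ≤ 16 * ((d : ℝ) - 1) * ((d : ℝ) - 2) * (2 * (d : ℝ) - 5) := by positivity
  have c2 : (0 : ℝ) ≤ 2 * ((d : ℝ) - 1) * ((d : ℝ) - 2) := by positivity
  have c3 : (0 : ℝ) ≤ (3 / 2) * (2 * (d : ℝ) - 2) * (2 * (d : ℝ) - 3) * (2 * (d : ℝ) - 4) := by
    have : (0 : ℝ) ≤ 2 * (d : ℝ) - 3 := by linarith
    have : (0 : ℝ) ≤ 2 * (d : ℝ) - 4 := by linarith
    positivity
  have t1 := mul_le_mul_of_nonneg_left (show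
      (1 - ((2 * (d : ℝ) - 2) * zs ^ 3 + zs + 2 * zs ^ 2 + 4 * zs ^ 3 + 4 * zs ^ 2 + 5 * zs ^ 3 + 11 * zs ^ 4 + 31 * zs ^ 5 +
        4 * ((d : ℝ) - 3) * (2 * zs ^ 3 + 12 * zs ^ 4 + 32 * zs ^ 5) + 32 * ((d : ℝ) - 3) ^ 2 * zs ^ 5) - 5 * Tmax - T3) ≤
      (1 - ((2 * (d : ℝ) - 2) * q ^ 3 + q + 2 * q ^ 2 + 4 * q ^ 3 + 4 * q ^ 2 + 5 * q ^ 3 + 11 * q ^ 4 + 31 * q ^ 5 +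
        4 * ((d : ℝ) - 3) * (2 * q ^ 3 + 12 * q ^ 4 + 32 * q ^ 5) + 32 * ((d : ℝ) - 3) ^ 2 * q ^ 5) - 5 * Tmax - T3) by linarith) c1
  have t2a := mul_le_mul_of_nonneg_left (show
      (16 - 8 * zs - 40 * zs ^ 2 - 56 * zs ^ 3 - 104 * zs ^ 4 - 32 * zs ^ 5 - 16 * zs ^ 6 - 16 * T3 - 80 * Tmax) ≤
      (16 - 8 * q - 40 * q ^ 2 - 56 * q ^ 3 - 104 * q ^ 4 - 32 * q ^ 5 - 16 * q ^ 6 - 16 * T3 - 80 * Tmax) by linarith) hd2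
  have t2b := mul_le_mul_of_nonneg_left hN (show (0 : ℝ) ≤ ((d : ℝ) - 3) ^ 2 by positivity)
  have t2 := mul_le_mul_of_nonneg_left (show
      ((d : ℝ) - 2) * (16 - 8 * zs - 40 * zs ^ 2 - 56 * zs ^ 3 - 104 * zs ^ 4 - 32 * zs ^ 5 - 16 * zs ^ 6 - 16 * T3 - 80 * Tmax) -
        ((d : ℝ) - 3) ^ 2 * (16 * zs ^ 3 + 144 * zs ^ 4 + 64 * zs ^ 5 + 32 * zs ^ 6) ≤
      ((d : ℝ) - 2) * (16 - 8 * q - 40 * q ^ 2 - 56 * q ^ 3 - 104 * q ^ 4 - 32 * q ^ 5 - 16 * q ^ 6 - 16 * T3 - 80 * Tmax) -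
        ((d : ℝ) - 3) ^ 2 * (16 * q ^ 3 + 144 * q ^ 4 + 64 * q ^ 5 + 32 * q ^ 6) by linarith) c2
  have t3 := mul_le_mul_of_nonneg_left (show (1 - 8 * zs ^ 2 - 5 * Tmax - T3) ≤ (1 - 8 * q ^ 2 - 5 * Tmax - T3) by linarith) c3
  simp only [psiHexBracket]
  linarith

/-- **Split-edge soundness**: for `0 ≤ zi ≤ q ≤ zs`, nonnegative letters and a nonnegative hexagon bracket at the upper edge, the engine's
split-edge value is below the diagonal value at `q` (hence, by `psiLowerCell_diag_le`, below `Ψ̂^{(0),κ}_q(0)`). [cite: FitznerVanDerHofstad2017, Lemma 5.3 (5.25); notebook Percolation.nb cell [109] (split-edge evaluation convention of the record's oracle row)] -/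
theorem psiLowerCell_split_le_diag (hd : 3 ≤ d) {zi q zs Tmax T3 T2 T11 : ℝ} (hzi : 0 ≤ zi) (hziq : zi ≤ q) (hqzs : q ≤ zs)
    (hTmax : 0 ≤ Tmax) (hT3 : 0 ≤ T3) (hT2 : 0 ≤ T2) (hT11 : 0 ≤ T11) (hB : 0 ≤ psiHexBracket d zs Tmax T3) :
    psiLowerCell d zi zs Tmax T3 T2 T11 ≤ psiLowerCell d q q Tmax T3 T2 T11 := by
  have hdR : (3 : ℝ) ≤ (d : ℝ) := by exact_mod_cast hd
  have hq : 0 ≤ q := hzi.trans hziq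
  rw [psiLowerCell_eq_split, psiLowerCell_eq_split]
  have hz4 : zi ^ 4 ≤ q ^ 4 := pow_le_pow_left₀ hzi hziq 4
  have hz6 : zi ^ 6 ≤ q ^ 6 := pow_le_pow_left₀ hzi hziq 6
  have hs4 : q ^ 4 ≤ zs ^ 4 := pow_le_pow_left₀ hq hqzs 4
  have hs7 : q ^ 7 ≤ zs ^ 7 := pow_le_pow_left₀ hq hqzs 7
  have hY : (0 : ℝ) ≤ (2 * (d : ℝ) - 2) * (2 * T2 + 2 * (2 * (d : ℝ) - 3) * T11 + 2 * Tmax + (2 * (d : ℝ) - 4) * Tmax) +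
      (2 * (d : ℝ) - 2) ^ 2 * T3 + 2 * ((d : ℝ) - 1) ^ 2 * (Tmax + 2 * T11 + T3) := by
    have : (0 : ℝ) ≤ 2 * (d : ℝ) - 2 := by linarith
    have : (0 : ℝ) ≤ 2 * (d : ℝ) - 3 := by linarith
    have : (0 : ℝ) ≤ 2 * (d : ℝ) - 4 := by linarith
    positivity
  have hc : (0 : ℝ) ≤ (2 * (d : ℝ) - 2) ^ 2 + 2 * ((d : ℝ) - 1) ^ 2 := by positivity
  have hc7 : (0 : ℝ) ≤ (2 * (d : ℝ) - 2) * (2 * (d : ℝ) - 3) ^ 2 := by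
    have : (0 : ℝ) ≤ 2 * (d : ℝ) - 2 := by linarith
    positivity
  have k1 := mul_le_mul_of_nonneg_left hz4 hc
  have k2 := mul_le_mul_of_nonneg_right hs4 hY
  have k3 := mul_le_mul_of_nonneg_left hs7 hc7
  have hK : psiLines123 d zi zs Tmax T3 T2 T11 ≤ psiLines123 d q q Tmax T3 T2 T11 := by
    simp only [psiLines123]
    linarith
  have hBq : psiHexBracket d zs Tmax T3 ≤ psiHexBracket d q Tmax T3 := psiHexBracket_antitone hd hq hqzs Tmax T3
  have m1 : zi ^ 6 * psiHexBracket d zs Tmax T3 ≤ q ^ 6 * psiHexBracket d zs Tmax T3 := mul_le_mul_of_nonneg_right hz6 hB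
  have m2 : q ^ 6 * psiHexBracket d zs Tmax T3 ≤ q ^ 6 * psiHexBracket d q Tmax T3 :=
    mul_le_mul_of_nonneg_left hBq (pow_nonneg hq 6)
  linarith

/-- **The engine's evaluated cell is a lower bound for `Ψ̂^{(0),κ}_p(0)` at every `p ∈ [zi, zs]`** (split-edge convention of the all-kernel
`N = 0` stack: main terms at the lower edge `zi = 1/(2d−1)`, subtracted terms at the upper edge `zs`).
[cite: FitznerVanDerHofstad2017, Lemma 5.3 (5.25) lines 1–5 (extended version arXiv:1506.07977v1 p. 48), proof §6.1 p. 61] -/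
theorem psiLowerCell_split_le (hd : 3 ≤ d) (p : unitInterval) (hp : p < criticalProbI d) {zi zs : ℝ}
    (hzi : 0 ≤ zi) (hzip : zi ≤ (p : ℝ)) (hpzs : (p : ℝ) ≤ zs)
    {a b c : Fin d} (hab : a ≠ b) (hac : a ≠ c) (hbc : b ≠ c) {T2 T11 T3 Tmax : ℝ}
    (hT2n : 0 ≤ T2) (hT11n : 0 ≤ T11) (hT3n : 0 ≤ T3) (hTmaxn : 0 ≤ Tmax) (hB : 0 ≤ psiHexBracket d zs Tmax T3)
    (h2 : tau d p 0 (Pi.single a 2) ≤ T2) (h11 : tau d p 0 (Pi.single a 1 + Pi.single b 1) ≤ T11)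
    (h21 : tau d p 0 (Pi.single a 2 + Pi.single b 1) ≤ Tmax)
    (h111 : tau d p 0 (Pi.single a 1 + Pi.single b 1 + Pi.single c 1) ≤ Tmax) (h3 : tauGe d p 3 (unitSite1 d) ≤ T3)
    (hT2 : T2 ≤ T11)
    (hmax : ∀ z : Site d, z ≠ 0 → (∀ ν : Fin d × Bool, z ≠ stepVec ν) → tau d p 0 z ≤ Tmax) (κ : Fin d × Bool) :
    psiLowerCell d zi zs Tmax T3 T2 T11 ≤ ∑' x, noblePsiN d p (stepVec κ) 0 x :=
  (psiLowerCell_split_le_diag hd hzi hzip hpzs hTmaxn hT3n hT2n hT11n hB).trans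
    (psiLowerCell_diag_le hd p hp hab hac hbc h2 h11 h21 h111 h3 hT2 hmax κ)

/-! ### The `Π^{(0),α}` lower cell (tokens k1def + k1ker) -/

/-- **The engine cell `Bound[Pi,alpha,lower,0,s]`** (row-file field `k1ker.form`, letters `T21 = T111 = Bound[G,max,2,s] = Tmax`), two edge variables.
[cite: FitznerVanDerHofstad2017, Lemma 5.3 (5.24) (extended version arXiv:1506.07977v1 p. 48)] -/
def piAlphaLowerCell (d : ℕ) (zi zs Tmax T3 T2 T11 : ℝ) : ℝ :=
  (2 * (d : ℝ) - 2) ^ 2 * zi ^ 4 - (2 * (d : ℝ) - 2) * zs ^ 4 * (2 * T2 + 2 * (2 * (d : ℝ) - 3) * T11 + 2 * Tmax + (2 * (d : ℝ) - 4) * Tmax) -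
    (2 * (d : ℝ) - 2) ^ 2 * zs ^ 4 * T3 - (2 * (d : ℝ) - 1) * (2 * (d : ℝ) - 2) * (2 * (d : ℝ) - 3) * zs ^ 7

/-- **Kernel identity (inventory rows C-8/C-9)**: on the diagonal the `Π^{(0),α}` cell is literally the left side of `FvdH17ext_L53_piAlpha_lower_of_tau_le`
with `T21 = T111 = Tmax`. [cite: FitznerVanDerHofstad2017, Lemma 5.3 (5.24) (extended version arXiv:1506.07977v1 p. 48)] -/
theorem piAlphaLowerCell_diag_eq (d : ℕ) (p : unitInterval) (Tmax T3 T2 T11 : ℝ) :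
    piAlphaLowerCell d (p : ℝ) (p : ℝ) Tmax T3 T2 T11 =
      (p : ℝ) * ((2 * d - 2 : ℝ) ^ 2 * (p : ℝ) ^ 3 -
        ((p : ℝ) ^ 3 * ((2 * d - 2 : ℝ) * (2 * T2 + 2 * (2 * d - 3 : ℝ) * T11 + 2 * Tmax + (2 * d - 4 : ℝ) * Tmax)) +
          (2 * d - 2 : ℝ) ^ 2 * (p : ℝ) ^ 3 * T3 + (2 * d - 1 : ℝ) * (2 * d - 2) * (2 * d - 3) * (p : ℝ) ^ 6)) := by
  simp only [piAlphaLowerCell]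
  ring

/-- The `Π^{(0),α}` cell on the diagonal is a lower bound for `Σ_κ Π^{(0),α}_{ι,κ}(e_ι)` — `FvdH17ext_L53_piAlpha_lower_of_tau_le` in the engine's letters.
[cite: FitznerVanDerHofstad2017, Lemma 5.3 (5.24) (extended version arXiv:1506.07977v1 p. 48), proof §6.1 p. 60] -/
theorem piAlphaLowerCell_diag_le (hd : 2 ≤ d) (p : unitInterval) (hp : p < criticalProbI d)
    {a b c : Fin d} (hab : a ≠ b) (hac : a ≠ c) (hbc : b ≠ c) {T2 T11 T3 Tmax : ℝ}
    (h2 : tau d p 0 (Pi.single a 2) ≤ T2) (h11 : tau d p 0 (Pi.single a 1 + Pi.single b 1) ≤ T11)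
    (h21 : tau d p 0 (Pi.single a 2 + Pi.single b 1) ≤ Tmax)
    (h111 : tau d p 0 (Pi.single a 1 + Pi.single b 1 + Pi.single c 1) ≤ Tmax) (h3 : tauGe d p 3 (unitSite1 d) ≤ T3)
    (ι : Fin d × Bool) :
    piAlphaLowerCell d (p : ℝ) (p : ℝ) Tmax T3 T2 T11 ≤ ∑ κ, (percolationNobleSplit d p hd hp).piA ι κ (stepVec ι) := by
  rw [piAlphaLowerCell_diag_eq]
  exact FvdH17ext_L53_piAlpha_lower_of_tau_le hd p hp hab hac hbc h2 h11 h21 h111 h3 ι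

/-- Split-edge monotonicity of the `Π^{(0),α}` cell: for `0 ≤ zi ≤ q ≤ zs` and nonnegative letters, the split-edge value is below the diagonal value at `q`
(`2 ≤ d`). [cite: FitznerVanDerHofstad2017, Lemma 5.3 (5.24); notebook Percolation.nb cell [109] (split-edge evaluation convention of the record's oracle row)] -/
theorem piAlphaLowerCell_split_le_diag (hd : 2 ≤ d) {zi q zs Tmax T3 T2 T11 : ℝ} (hzi : 0 ≤ zi) (hziq : zi ≤ q) (hqzs : q ≤ zs)
    (hTmax : 0 ≤ Tmax) (hT3 : 0 ≤ T3) (hT2 : 0 ≤ T2) (hT11 : 0 ≤ T11) :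
    piAlphaLowerCell d zi zs Tmax T3 T2 T11 ≤ piAlphaLowerCell d q q Tmax T3 T2 T11 := by
  have hdR : (2 : ℝ) ≤ (d : ℝ) := by exact_mod_cast hd
  have hq : 0 ≤ q := hzi.trans hziq
  have hz4 : zi ^ 4 ≤ q ^ 4 := pow_le_pow_left₀ hzi hziq 4
  have hs4 : q ^ 4 ≤ zs ^ 4 := pow_le_pow_left₀ hq hqzs 4
  have hs7 : q ^ 7 ≤ zs ^ 7 := pow_le_pow_left₀ hq hqzs 7
  have h2d2 : (0 : ℝ) ≤ 2 * (d : ℝ) - 2 := by linarith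
  have hY : (0 : ℝ) ≤ (2 * (d : ℝ) - 2) * (2 * T2 + 2 * (2 * (d : ℝ) - 3) * T11 + 2 * Tmax + (2 * (d : ℝ) - 4) * Tmax) +
      (2 * (d : ℝ) - 2) ^ 2 * T3 := by
    have : (0 : ℝ) ≤ 2 * (d : ℝ) - 3 := by linarith
    have : (0 : ℝ) ≤ 2 * (d : ℝ) - 4 := by linarith
    positivity
  have hc7 : (0 : ℝ) ≤ (2 * (d : ℝ) - 1) * (2 * (d : ℝ) - 2) * (2 * (d : ℝ) - 3) := by
    have : (0 : ℝ) ≤ 2 * (d : ℝ) - 1 := by linarith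
    have : (0 : ℝ) ≤ 2 * (d : ℝ) - 3 := by linarith
    positivity
  have k1 := mul_le_mul_of_nonneg_left hz4 (sq_nonneg (2 * (d : ℝ) - 2))
  have k2 := mul_le_mul_of_nonneg_right hs4 hY
  have k3 := mul_le_mul_of_nonneg_left hs7 hc7
  simp only [piAlphaLowerCell]
  nlinarith [k1, k2, k3]

/-- **The engine's evaluated `Π^{(0),α}` cell is a lower bound at every `p ∈ [zi, zs]`** (split-edge convention).
[cite: FitznerVanDerHofstad2017, Lemma 5.3 (5.24) (extended version arXiv:1506.07977v1 p. 48), proof §6.1 p. 60] -/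
theorem piAlphaLowerCell_split_le (hd : 2 ≤ d) (p : unitInterval) (hp : p < criticalProbI d) {zi zs : ℝ}
    (hzi : 0 ≤ zi) (hzip : zi ≤ (p : ℝ)) (hpzs : (p : ℝ) ≤ zs)
    {a b c : Fin d} (hab : a ≠ b) (hac : a ≠ c) (hbc : b ≠ c) {T2 T11 T3 Tmax : ℝ}
    (hT2n : 0 ≤ T2) (hT11n : 0 ≤ T11) (hT3n : 0 ≤ T3) (hTmaxn : 0 ≤ Tmax)
    (h2 : tau d p 0 (Pi.single a 2) ≤ T2) (h11 : tau d p 0 (Pi.single a 1 + Pi.single b 1) ≤ T11)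
    (h21 : tau d p 0 (Pi.single a 2 + Pi.single b 1) ≤ Tmax)
    (h111 : tau d p 0 (Pi.single a 1 + Pi.single b 1 + Pi.single c 1) ≤ Tmax) (h3 : tauGe d p 3 (unitSite1 d) ≤ T3)
    (ι : Fin d × Bool) :
    piAlphaLowerCell d zi zs Tmax T3 T2 T11 ≤ ∑ κ, (percolationNobleSplit d p hd hp).piA ι κ (stepVec ι) :=
  (piAlphaLowerCell_split_le_diag hd hzi hzip hpzs hTmaxn hT3n hT2n hT11n).trans
    (piAlphaLowerCell_diag_le hd p hp hab hac hbc h2 h11 h21 h111 h3 ι)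

end N0Cells

end Literature.Probability.FitznerVanDerHofstad2017

end
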